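import Summits.HodgeConjecture.HodgeConjecture.Cruxes.BlochSeedDiscOne.SeedCheckerSplitBlockCFree
import Literature.AlgebraicGeometry.Modules.DetClassTensor
import Literature.AlgebraicGeometry.Modules.DetClassDual
import Literature.AlgebraicGeometry.Modules.LocalFrames
import Literature.AlgebraicGeometry.Modules.IsoLocusOfHom
import Literature.AlgebraicGeometry.AbelianVarieties.LineBundleTensorPower
import Literature.AlgebraicGeometry.Modules.LineBundleOfCocycleClass
import Literature.AlgebraicGeometry.Modules.RankOneModuleDivisorDictionary
import Literature.AlgebraicGeometry.Motives.CurvePointDivisor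
import Literature.AlgebraicGeometry.HodgeTheory.CurvePoleSpaces
import HarnessLib

/-!
# Seed checker v42.3 — LETTER BUNDLES: exact rank one (R1), the pinning interface (R2), the C-free letter construction
# `letterBundle θ ψ₀ Z = ⊗_f π_f^* L_S(Z_f)` (R3) and its parameter-free pin `θ₀ = 𝒪_{E₀}(o)` (`originLine`, `originLaw`) for the C-free split-block datum of v42.1

Cell `hsemireg-c5c8-1` g55 (TYPING-SPEC owner), ADDITIVE module next to v42.1 `SeedCheckerSplitBlockCFree.lean` (1bcdc3c1de7a79a0, of record)
and v42.2 `SeedCheckerSplitBlockSheafBridge.lean` (beb67042b20e2755); nothing of v41 ∕ v42.1 ∕ v42.2 is re-cut.  Commission: director-hodge g33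
R19.877 (F6′)(iii) «R3 COMMISSIONED @c5c8-1 g55 as v42.3: CONSTRUCT `letterBundle` (Z ↦ ⊠_f 𝒪(a_f·o) ⊗ P_{β_f} on the pad-4 anchor, over existing
tree decls) and a pinned kit so that hsem-3's bench (`Critic.padZero` ∕ `Critic.relabel`, memo-212 `V42ZeroLettersImport.lean`) FAILS to produce an
admissible datum = R2's ACCEPTANCE TEST; ship R1 (`HasRank (L Z) 1` exact) as the interim in the same v42.3».

## The disease (idea-crit-hsem-3 memo-212 (f6), CONFIRMED ×2 by hsem-2 memo-179; director (F6′))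
v42.1's `LetterKit₀` is FREE DATA `L : MCell → Modules` with only `HasRankLE (L Z) 1`; the zero module has `HasRankLE 0 1`, so (i) ZERO LETTERS may be
padded onto fresh cells (`Critic.padZero`) and (ii) honest letters may be MOVED along any multiplicity-matching bijection of cells (`Critic.relabel`):
`Passes` is json-decided, every padding-stable law transfers, and the junk designs defeat the rows (`rung2b₀With_iff_not_rung2a₀`).

## What this file supplies (all C-FREE: no `ChernCharacterBetti` on any path)
* §43.1 `not_isZero_of_hasRank_one` — on the pad-4 anchor variety a module of (exact) rank one is NOT a zero object (the anchor is an integral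
  scheme: a local frame of size one at a point has a basis section with coordinate `1 ≠ 0`).  KILLS (i) for every exact-rank-one kit.
* §43.2 (R1) `LetterKit₀.ExactRankOne`, `SplitBlockCore₀.LettersRankOne`, the law `rankOneLaw : DatumLaw` (slot of v42.1 `Rung2a₀Under Λ`), and
  `LettersRankOne.not_isZero_P ∕ _N`.
* §43.3 (R2, interface) `LetterModel E₀` = a C-free assignment `bundle : MCell → Modules` of EXACT rank one (an INTERFACE: nothing asserts one is
  honest; §43.5 CONSTRUCTS instances); `LetterModel.Separating` (non-isomorphic letters on distinct cells — the obligation that kills (ii));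
  `SplitBlockCore₀.PinnedTo ℓ` ∕ `SplitBlockDatum₀.PinnedTo ℓ` (every letter of the core IS, up to iso, the model's bundle of ITS cell) and the law
  `pinnedLaw ℓ : DatumLaw`; consequences `PinnedTo.lettersRankOne`, `PinnedTo.not_isZero_P ∕ _N` (no zero letter: KILLS (i)), `PinnedTo.cell_eq_P ∕ _N`
  (two pinned cores whose letters on cells `Z`, `Z'` are isomorphic have `Z = Z'` once `ℓ` separates: KILLS (ii) — a relabelling `σ` pinned before
  and after is the identity on cells).
* §43.4 the on-path ∕ kill-path readings in v42.1's law slot: `Rung2a₀Pinned ℓ h := Rung2a₀Under (pinnedLaw ℓ) h`, `rung2a₀_of_rung2a₀Pinned`,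
  `rung2a₀Under_rankOneLaw_of_rung2a₀Pinned`.
* §43.5 (R3, construction) over EXISTING tree declarations only (`AbelianVariety.fst ∕ snd ∕ prodLift`, the preadditive structure on `E₀ ⟶ E₀`,
  `Hom.toSchemeHom`, Mathlib `Scheme.Modules.pullback`, the tree's `Modules.tensorObj ∕ tensorPow ∕ dual`): for a module `θ` on `E₀` (INTENDED: the
  degree-one line bundle `𝒪_{E₀}(o)`) and the CM generator `ψ₀`, on the Weil surface `S = E₀ × E₀` with projections `p, q : S → E₀`
  `U = p^*θ`, `V = q^*θ`, `Δ = (p − q)^*θ` (class `[Γ_1]`, the diagonal), `Γ = (p ≫ ψ₀ − q)^*θ` (class `[Γ_{ψ₀}]`, the graph), `H = U ⊗ V` (class `u + v`),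
  `D₁ = Δ ⊗ H^∨` (class `e₁ = [Γ_1] − u − v`), `D₂ = Γ ⊗ H^∨` (class `e₂ = [Γ_{ψ₀}] − u − v`); for a factor point `b = (a, x, y)` the FACTOR LETTER
  `L_S(b) = H^{⊗a} ⊗ D₁^{⊗x} ⊗ D₂^{⊗y}` (integer exponents: negative = powers of the dual), and for a cell `Z : Fin 4 → BPoint` the LETTER BUNDLE
  `letterBundle θ ψ₀ Z = ⊗_{f<4} π_f^* L_S(Z_f)` on `S⁴ = pad4Anchor E₀` (`π_f = padProj E₀ f`, factor `f` = the `f`-th slot of the nested product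
  `((S × S) × S) × S`, `π₀ = fst ≫ fst ≫ fst`, …, `π₃ = snd`).  `hasRank_letterBundle : HasRank θ 1 → HasRank (letterBundle θ ψ₀ Z) 1`, hence the
  INSTANCE `letterModelOf θ hθ ψ₀ : LetterModel E₀` of the §43.3 interface, and the pinned law `letterLaw θ hθ : DatumLaw`.
  DICTIONARY (why these are the letters the pen's rows mean): with `θ = 𝒪(o)`, `e₁² = e₂² = −2`, `e₁·e₂ = e₁·(u+v) = e₂·(u+v) = 0` (`ψ₀` an
  automorphism, `#Fix(ψ₀) = |1 − i|² = 2`), so `e = (e₁ − i e₂)/2`, `ē` satisfy `e² = ē² = 0`, `e·ē = −1` and `βe + β̄ē = x e₁ + y e₂` for `β = x + iy`: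
  `c₁(L_S(a, x, y)) = a(u + v) + βe + β̄ē`, the class `bphi (a, x, y)` of `Pad4TowerPsiSubA1` reads in degree `2` — up to the conjugation convention
  `β ↦ β̄` (`ψ₀ ↦ −ψ₀`) fixed by the word frame, a DESIGN SYMMETRY (`MCell.conj`).  This identification is DOCUMENTATION here: the C-free file never
  reads a class; the C-sentence «`ch(letterBundle θ ψ₀ Z) = Z.ch` through `(C, Φ)`» is the OFF-PATH predicate `LetterModel.RealisedThrough`.
* §43.6 (R3, the pin itself — NO free parameter left) `originLine E₀ h1 = 𝒪_{E₀}(o)` for `h1 : E₀.dim = 1`, CONSTRUCTED over tree decls: the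
  origin `o = originPt E₀ ∈ E₀(ℂ)` (unit section `AbelianVariety.unitPt`), `origin_ne_genericPoint` (a complex point of the smooth curve `E₀` —
  `smoothOfRelativeDimension_dim` at `dim = 1` — is closed: `HodgeTheory.pt_ne_genericPoint`), the reduced effective Cartier divisor
  `originDivisor E₀ h1 = [o]` (`Motives.CurvePlaces.pointDivisor`, Hartshorne II.6.11), and `originLine = Modules.lineBundle [o].toUnitCocycle`
  (Görtz–Wedhorn I 11.21) with `hasRank_originLine` (`UnitCocycle.hasRank_lineBundle`).  Hence the PARAMETER-FREE letter model
  `originModel E₀ h1 ψ₀ := letterModelOf (originLine E₀ h1) _ ψ₀`, the law `originLaw : DatumLaw` («`∃ h1, δ.PinnedTo (originModel E₀ h1 ψ₀)`»),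
  the rung reading `Rung2a₀Origin h := Rung2a₀Under originLaw h` with `rung2a₀_of_rung2a₀Origin`, `rung2a₀Under_rankOneLaw_of_rung2a₀Origin`, and the
  ONE remaining typed obligation `OriginSeparating` (the Néron–Severi injectivity `(a, x, y)_f ↦ c₁`, documented TRUE, not proved here).
* §43.7 `audit_nothing_decided_letterBundle`.

## Cites (director R19.885: cite, do not re-type) and position (R19.883 (F-B′))
* sheaf8-1 g10 `Cruxes/BlochSeedDiscOne/SplitBlockClassRows.lean` (65818a3eadd27e40, crux commit dd7ea1eda8ad; namespace `…SplitBlock.ClassRows`):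
  the CLASS-ROW dictionary `ClassRows.stub_classRows` (law-free support row of the registered `Lines/splitblock.lean` v2 ab08aaed15d375b0).  The §43.5
  Néron–Severi DICTIONARY below is prose deferring to it; this file re-types none of it and READS NO CLASS.
* idea-crit-hsem-3 g25 memo-213 `Memo213RealisableBench.lean` (16348300a1b04002): the C-TIED acceptance test (`δ.Realisable := ∃ C, … ∧ δ.Realises C`:
  ghost letters fail the tie for every `C` by `ch₀ = 1 ≠ 0`; relabellings survive only as the identity in a separating frame, or `q = −1` on all-level-zero
  shells).  THIS file is the C-FREE complement the director asked for in (F-B′): its pin (`originLaw`) and its kills name no `ChernCharacterBetti`, hence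
  carry NO 19780 price (`Nonempty ChernCharacterBetti`) and no LEMMA-U price; and MODULE pinning closes memo-213's `q = −1` residual too (the letters of
  `(0, x, y)` and `(0, −x, −y)` are non-isomorphic line bundles, classes `±(x e₁ + y e₂)`), given `OriginSeparating`.

## Acceptance test (R2, run at HOME, not a tree import of hsem-3's file)
HOME `hsemireg-c5c8-1/g55/probe/LabelBench.lean` instantiates §43.3 on hsem-3's critics: `Critic.padZero δ p` with a fresh cell is NEVER `PinnedTo ℓ`
(its fresh letters are zero objects: `Critic.isZero_cutOffTerm_L` versus `PinnedTo.not_isZero_P ∕ _N`), and `Critic.relabel δ r` pinned to a separating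
`ℓ` before and after forces `r.σP`, `r.σN` to fix every cell.  Verdict + sha16 in the cell's bus RESULT line.

## Honest limits (said, not hidden)
(a) `LetterModel` is an interface; `letterModelOf θ hθ ψ₀` instantiates it for EVERY rank-one `θ` — including the dishonest `θ = 𝒪` (all letters
trivial, `letterModel_nonempty`).  The law of record `originLaw` therefore pins to the CONSTRUCTED `θ₀ = originLine E₀ h1 = 𝒪_{E₀}(o)` (§43.6), leaving
no parameter; what is NOT proved here is `OriginSeparating` (`(originModel E₀ h1 ψ₀).Separating`: non-isomorphic letters on distinct cells — true by
the Néron–Severi computation above, `u + v, e₁, e₂` having Gram matrix `diag(2, −2, −2)` on `S` and Künneth on `S⁴`), the typed obligation on which the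
kill of (ii) (relabelling) rests; the kill of (i) needs nothing.
(b) The kill of (i) (zero letters) is UNCONDITIONAL for every pinned or exact-rank-one core (§43.1).  (c) Pinning does not touch `Passes`, the frame
`S'`, the section or the subscheme: it constrains the PRESENTATION only, which is what (f6) is about.  (d) Nothing here is proved toward HC ∕ HC_CM ∕
HC_AV ∕ №4 ∕ 26512 ∕ 18881 ∕ 18880 ∕ 27388 ∕ 30548 ∕ H2; `stub_rung_pad4_seedAt` and `Lines/*` untouched; letters ≠ sheaves ≠ SEED; typed ≠ proved.
No `sorry`, no new axiom, no `instance`, no notation.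
-/

set_option linter.dupNamespace false
set_option autoImplicit false

open CategoryTheory CategoryTheory.Limits AlgebraicGeometry Opposite
open Literature.AlgebraicGeometry Literature.AlgebraicGeometry.Motives Literature.AlgebraicGeometry.HodgeTheory
open Literature.AlgebraicGeometry.Modules Literature.AlgebraicGeometry.AbelianVarieties
open Literature.AlgebraicTopology.SingularHomology

noncomputable section

namespace Summit.HodgeConjecture.HodgeConjecture.Cruxes.BlochSeedDiscOne.SeedChecker

open Summit.HodgeConjecture.HodgeConjecture.Cruxes.BlochSeedDiscOne.Anchor
open Summit.Ventures.HSemireg Summit.Ventures.HSemireg.Pad4Tower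

namespace SplitBlock

/-! ## §43.1 A rank-one module on an integral scheme is not a zero object -/

section NotZero

universe u

/-- **A module of exact rank one over a point with non-trivial local section rings is not a zero object**: a frame `𝒪^{I_x} ≅ E|_{U_x}` of size
one at `x` has a basis section `b` with coordinate `λ(b) = 1`; if `E = 0` then `b = 0` and `1 = λ(0) = 0` in `Γ(X, U_x)`. [folklore; Hartshorne II §5] -/
theorem not_isZero_of_hasRank_one_of_point {X : Scheme.{u}} {E : X.Modules} (x : X)
    (hx : ∀ U : X.Opens, x ∈ U → Nontrivial Γ(X, U)) (hE : HasRank E 1) : ¬ IsZero E := by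
  intro h0
  obtain ⟨F, hF⟩ := exists_frameSystem_of_hasRank hE
  haveI : Nontrivial Γ(X, F.U x) := hx (F.U x) (F.mem x)
  let i : F.I x := (F.enum x).symm (Fin.cast (hF x).symm 0)
  have hb : basisSection (F.frame x) i = 0 := app_eq_zero_of_isZero h0 (F.U x) _
  have h1 : coord (F.frame x) (𝟙 (F.U x)) (basisSection (F.frame x) i) i = 1 := by
    rw [coord_basisSection, if_pos rfl]
  have h2 : coord (F.frame x) (𝟙 (F.U x)) (basisSection (F.frame x) i) i = 0 := by
    rw [hb, coord_def, appLE_def]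
    exact map_zero _
  exact one_ne_zero (h1.symm.trans h2)

/-- **On an integral scheme a module of exact rank one is not a zero object.** [folklore] -/
theorem not_isZero_of_hasRank_one_of_isIntegral {X : Scheme.{u}} [IsIntegral X] {E : X.Modules} (hE : HasRank E 1) : ¬ IsZero E := by
  obtain ⟨x⟩ := (inferInstance : Nonempty X)
  refine not_isZero_of_hasRank_one_of_point x (fun U hU => ?_) hE
  haveI : Nonempty U := ⟨⟨x, hU⟩⟩
  infer_instance

/-- **On the pad-4 anchor variety `S⁴` (an abelian variety over `ℂ`, hence an integral scheme) a module of exact rank one is not zero.** -/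
theorem not_isZero_of_hasRank_one {E₀ : AbelianVariety ℂ} {M : (pad4Anchor E₀).X.left.Modules} (hM : HasRank M 1) : ¬ IsZero M := by
  haveI : IsIntegral (pad4Anchor E₀).X.left := GeometricallyIntegral.isIntegral_of_subsingleton (pad4Anchor E₀).X.hom
  exact not_isZero_of_hasRank_one_of_isIntegral hM

end NotZero

variable {E₀ : AbelianVariety ℂ} {ψ₀ : E₀ ⟶ E₀}

/-! ## §43.2 (R1) exact rank one of the letters -/

namespace LetterKit₀

variable {s : Finset MCell}

/-- **(R1) the kit's letters have EXACT rank one** on its cells (v42.1 asks only `HasRankLE · 1`, which the zero module satisfies). -/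
def ExactRankOne (k : LetterKit₀ E₀ s) : Prop :=
  ∀ Z ∈ s, HasRank (k.L Z) 1

theorem ExactRankOne.not_isZero {k : LetterKit₀ E₀ s} (h : k.ExactRankOne) {Z : MCell} (hZ : Z ∈ s) : ¬ IsZero (k.L Z) :=
  not_isZero_of_hasRank_one (h Z hZ)

end LetterKit₀

namespace SplitBlockCore₀

/-- **(R1) both kits of the core have exact-rank-one letters.** -/
def LettersRankOne (δ : SplitBlockCore₀ E₀ ψ₀) : Prop :=
  δ.termP.kit.ExactRankOne ∧ δ.termN.kit.ExactRankOne

theorem LettersRankOne.not_isZero_P {δ : SplitBlockCore₀ E₀ ψ₀} (h : δ.LettersRankOne) {P : MCell} (hP : P ∈ δ.Dsh.cfg.upper) :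
    ¬ IsZero (δ.termP.kit.L P) :=
  h.1.not_isZero hP

theorem LettersRankOne.not_isZero_N {δ : SplitBlockCore₀ E₀ ψ₀} (h : δ.LettersRankOne) {N : MCell} (hN : N ∈ δ.Dsh.cfg.lower) :
    ¬ IsZero (δ.termN.kit.L N) :=
  h.2.not_isZero hN

end SplitBlockCore₀

/-- **(R1) as a datum law** (slot `Λ` of v42.1 `Rung2a₀Under Λ h` ∕ `Rung2b₀Under Λ h Rows`). -/
def rankOneLaw : DatumLaw := fun _ _ δ => δ.toSplitBlockCore₀.LettersRankOne

/-! ## §43.3 (R2) the letter-model interface and PINNING -/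

/-- **A C-FREE LETTER MODEL on the anchor `E₀`**: to every cell a module of EXACT rank one on `S⁴` — the letter the cell's numerics NAME.  An
INTERFACE (§43.5 constructs instances from a rank-one module on `E₀`); no Chern character theory, no class is read. -/
structure LetterModel (E₀ : AbelianVariety ℂ) where
  /-- the letter bundle of a cell -/
  bundle : MCell → (pad4Anchor E₀).X.left.Modules
  hasRank_one : ∀ Z, HasRank (bundle Z) 1

namespace LetterModel

variable (ℓ : LetterModel E₀)

theorem not_isZero (Z : MCell) : ¬ IsZero (ℓ.bundle Z) :=
  not_isZero_of_hasRank_one (ℓ.hasRank_one Z)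

/-- **the model SEPARATES cells**: letters of distinct cells are not isomorphic (for the intended letters: the Néron–Severi classes
`a(u+v) + x e₁ + y e₂` per factor are pairwise distinct).  The typed obligation under which relabelling dies. -/
def Separating : Prop :=
  ∀ Z Z' : MCell, Nonempty (ℓ.bundle Z ≅ ℓ.bundle Z') → Z = Z'

/-- OFF PATH: the model's letters are realised through a Chern character theory `C` in the word frame `Φ` (the v41 modelling sentence, now a
property OF THE MODEL, checkable once per anchor — never a field of a datum). -/
def RealisedThrough (C : ChernCharacterBetti) (Φ : WordFrame E₀) : Prop :=
  ∀ Z : MCell, RealisesTensor C Φ (ℓ.bundle Z) Z.ch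

/-- the model's kit on any finite set of cells (a v42.1 `LetterKit₀` whose letters ARE the model's). -/
def kit (s : Finset MCell) : LetterKit₀ E₀ s :=
  ⟨ℓ.bundle, fun Z _ => (ℓ.hasRank_one Z).hasRankLE⟩

@[simp] theorem kit_L (s : Finset MCell) (Z : MCell) : (ℓ.kit s).L Z = ℓ.bundle Z := rfl

theorem kit_exactRankOne (s : Finset MCell) : (ℓ.kit s).ExactRankOne := fun Z _ => ℓ.hasRank_one Z

end LetterModel

namespace SplitBlockCore₀

variable (δ : SplitBlockCore₀ E₀ ψ₀) (ℓ : LetterModel E₀)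

/-- **THE CORE IS PINNED TO THE MODEL**: every letter of the `P`-term and of the `N`-term is, up to isomorphism, the model's bundle OF ITS OWN CELL.
(Letters stay data — the injections ∕ projections of `BlockTerm₀` need them as objects — but WHICH module sits on a cell is no longer free.) -/
def PinnedTo : Prop :=
  (∀ P ∈ δ.Dsh.cfg.upper, Nonempty (δ.termP.kit.L P ≅ ℓ.bundle P)) ∧ (∀ N ∈ δ.Dsh.cfg.lower, Nonempty (δ.termN.kit.L N ≅ ℓ.bundle N))

variable {δ ℓ}

/-- a pinned core has exact-rank-one letters (R2 ⟹ R1). -/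
theorem PinnedTo.lettersRankOne (h : δ.PinnedTo ℓ) : δ.LettersRankOne :=
  ⟨fun P hP => (h.1 P hP).elim fun e => hasRank_of_iso e.symm (ℓ.hasRank_one P),
    fun N hN => (h.2 N hN).elim fun e => hasRank_of_iso e.symm (ℓ.hasRank_one N)⟩

/-- **no zero letter in a pinned core** (`P`-side) — the kill of zero-letter padding. -/
theorem PinnedTo.not_isZero_P (h : δ.PinnedTo ℓ) {P : MCell} (hP : P ∈ δ.Dsh.cfg.upper) : ¬ IsZero (δ.termP.kit.L P) :=
  h.lettersRankOne.not_isZero_P hP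

/-- **no zero letter in a pinned core** (`N`-side). -/
theorem PinnedTo.not_isZero_N (h : δ.PinnedTo ℓ) {N : MCell} (hN : N ∈ δ.Dsh.cfg.lower) : ¬ IsZero (δ.termN.kit.L N) :=
  h.lettersRankOne.not_isZero_N hN

/-- a core with a zero letter on one of its cells is pinned to NO model. -/
theorem not_pinnedTo_of_isZero_P {P : MCell} (hP : P ∈ δ.Dsh.cfg.upper) (h0 : IsZero (δ.termP.kit.L P)) : ¬ δ.PinnedTo ℓ :=
  fun h => h.not_isZero_P hP h0

theorem not_pinnedTo_of_isZero_N {N : MCell} (hN : N ∈ δ.Dsh.cfg.lower) (h0 : IsZero (δ.termN.kit.L N)) : ¬ δ.PinnedTo ℓ :=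
  fun h => h.not_isZero_N hN h0

/-- **PINNED LETTERS NAME THEIR CELLS** (`P`-side): if two cores are pinned to a separating model and the letter of `δ` on `P` is isomorphic to the
letter of `δ'` on `P'`, then `P = P'` — the kill of relabelling (a relabelled core carries on `P'` the letter of `σ P'`). -/
theorem PinnedTo.cell_eq_P {δ δ' : SplitBlockCore₀ E₀ ψ₀} (h : δ.PinnedTo ℓ) (h' : δ'.PinnedTo ℓ) (hs : ℓ.Separating) {P P' : MCell}
    (hP : P ∈ δ.Dsh.cfg.upper) (hP' : P' ∈ δ'.Dsh.cfg.upper) (e : δ.termP.kit.L P ≅ δ'.termP.kit.L P') : P = P' :=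
  (h.1 P hP).elim fun i => (h'.1 P' hP').elim fun i' => hs P P' ⟨i.symm ≪≫ e ≪≫ i'⟩

/-- **PINNED LETTERS NAME THEIR CELLS** (`N`-side). -/
theorem PinnedTo.cell_eq_N {δ δ' : SplitBlockCore₀ E₀ ψ₀} (h : δ.PinnedTo ℓ) (h' : δ'.PinnedTo ℓ) (hs : ℓ.Separating) {N N' : MCell}
    (hN : N ∈ δ.Dsh.cfg.lower) (hN' : N' ∈ δ'.Dsh.cfg.lower) (e : δ.termN.kit.L N ≅ δ'.termN.kit.L N') : N = N' :=
  (h.2 N hN).elim fun i => (h'.2 N' hN').elim fun i' => hs N N' ⟨i.symm ≪≫ e ≪≫ i'⟩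

end SplitBlockCore₀

namespace SplitBlockDatum₀

/-- the datum is pinned to the model (its core is). -/
def PinnedTo (δ : SplitBlockDatum₀ E₀ ψ₀) (ℓ : LetterModel E₀) : Prop :=
  δ.toSplitBlockCore₀.PinnedTo ℓ

theorem PinnedTo.lettersRankOne {δ : SplitBlockDatum₀ E₀ ψ₀} {ℓ : LetterModel E₀} (h : δ.PinnedTo ℓ) : δ.toSplitBlockCore₀.LettersRankOne :=
  SplitBlockCore₀.PinnedTo.lettersRankOne h

end SplitBlockDatum₀

/-- **a family of letter models, one per CM anchor** (what a `DatumLaw` can quantify over). -/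
abbrev LetterModels := ∀ (E₀ : AbelianVariety ℂ), (E₀ ⟶ E₀) → LetterModel E₀

/-- **(R2) PINNING AS A DATUM LAW** (slot `Λ` of v42.1): the datum's letters are the model's. -/
def pinnedLaw (ℓ : LetterModels) : DatumLaw := fun E₀ ψ₀ δ => δ.PinnedTo (ℓ E₀ ψ₀)

theorem rankOneLaw_of_pinnedLaw (ℓ : LetterModels) {E₀ : AbelianVariety ℂ} {ψ₀ : E₀ ⟶ E₀} {δ : SplitBlockDatum₀ E₀ ψ₀}
    (h : pinnedLaw ℓ E₀ ψ₀ δ) : rankOneLaw E₀ ψ₀ δ :=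
  SplitBlockDatum₀.PinnedTo.lettersRankOne h

/-! ## §43.4 the readings in v42.1's law slot (additive; `Rung2a₀`, `Rung2a₀Under`, `Rung2b₀Under` are v42.1's, untouched) -/

/-- **RUNG 2a₀ PINNED**: some positive passing in-scope C-free datum whose letters ARE the model's. -/
def Rung2a₀Pinned (ℓ : LetterModels) (h : ℤ) : Prop :=
  Rung2a₀Under (pinnedLaw ℓ) h

theorem rung2a₀_of_rung2a₀Pinned {ℓ : LetterModels} {h : ℤ} (h2a : Rung2a₀Pinned ℓ h) : Rung2a₀ h :=
  Rung2a₀Under.rung2a₀ h2a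

theorem rung2a₀Under_rankOneLaw_of_rung2a₀Pinned {ℓ : LetterModels} {h : ℤ} (h2a : Rung2a₀Pinned ℓ h) : Rung2a₀Under rankOneLaw h := by
  obtain ⟨E₀, ψ₀, hE, hψ, δ, hΛ, hpos, hδ, hscope⟩ := h2a
  exact ⟨E₀, ψ₀, hE, hψ, δ, rankOneLaw_of_pinnedLaw ℓ hΛ, hpos, hδ, hscope⟩

/-- the 2b₀-under-a-law kill path specialised to the pinned law: rows on every pinned positive passing in-scope datum contradict a pinned 2a₀
whose shadow fails the rows. [logic over v42.1 `Rung2b₀Under`] -/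
theorem rows_of_rung2b₀Under_pinnedLaw {ℓ : LetterModels} {h : ℤ} {Rows : DepthBoundA4.Design → Prop} (h2b : Rung2b₀Under (pinnedLaw ℓ) h Rows)
    {E₀ : AbelianVariety ℂ} {ψ₀ : E₀ ⟶ E₀} (hE : E₀.dim = 1) (hψ : ψ₀ ≫ ψ₀ = -(1 • 𝟙 E₀)) (δ : SplitBlockDatum₀ E₀ ψ₀)
    (hpin : δ.PinnedTo (ℓ E₀ ψ₀)) (hpos : δ.Dsh.Positive) (hδ : δ.Passes) (hscope : ScopeRows h δ.Dsh.shadow) : Rows δ.Dsh.shadow :=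
  h2b E₀ ψ₀ hE hψ δ hpin hpos hδ hscope

/-! ## §43.5 (R3) THE C-FREE LETTER CONSTRUCTION `letterBundle θ ψ₀ Z = ⊗_f π_f^* L_S(Z_f)` -/

section Construction

/-- pull-back of a module along a morphism of abelian varieties (Mathlib `Scheme.Modules.pullback` of the underlying scheme map). -/
abbrev pullLine {A B : AbelianVariety ℂ} (φ : A ⟶ B) (M : B.X.left.Modules) : A.X.left.Modules :=
  (Scheme.Modules.pullback (AbelianVariety.Hom.toSchemeHom φ)).obj M

theorem hasRank_pullLine {A B : AbelianVariety ℂ} (φ : A ⟶ B) {M : B.X.left.Modules} (hM : HasRank M 1) : HasRank (pullLine φ M) 1 :=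
  hasRank_pullback _ hM

/-- **integer tensor powers of a module**: `M^{⊗ n}` for `n ≥ 0`, `(M^∨)^{⊗ |n|}` for `n < 0` (for a line bundle: the `n`-th power in `Pic`). -/
def zpowLine {X : Scheme.{0}} (M : X.Modules) : ℤ → X.Modules
  | (n : ℕ) => tensorPow M n
  | Int.negSucc n => tensorPow (Modules.dual M) (n + 1)

theorem hasRank_zpowLine {X : Scheme.{0}} {M : X.Modules} (hM : HasRank M 1) : ∀ n : ℤ, HasRank (zpowLine M n) 1
  | (n : ℕ) => hasRank_tensorPow_one hM n
  | Int.negSucc n => hasRank_tensorPow_one (hasRank_dual hM) (n + 1)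

variable (E₀) in
/-- **the `f`-th factor projection `π_f : S⁴ → S`** of the nested product `pad4Anchor E₀ = ((S × S) × S) × S` (CONVENTION: factor `0` = outermost
first slot, factor `3` = last slot). -/
def padProj : Fin 4 → (pad4Anchor E₀ ⟶ weilSurf E₀)
  | ⟨0, _⟩ => AbelianVariety.fst _ _ ≫ AbelianVariety.fst _ _ ≫ AbelianVariety.fst _ _
  | ⟨1, _⟩ => AbelianVariety.fst _ _ ≫ AbelianVariety.fst _ _ ≫ AbelianVariety.snd _ _
  | ⟨2, _⟩ => AbelianVariety.fst _ _ ≫ AbelianVariety.snd _ _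
  | ⟨_ + 3, _⟩ => AbelianVariety.snd _ _

/-- `U = p^*θ` on `S = E₀ × E₀` (class `u = [o × E₀]` for `θ = 𝒪(o)`). -/
def lineU (θ : E₀.X.left.Modules) : (weilSurf E₀).X.left.Modules := pullLine (AbelianVariety.fst E₀ E₀) θ
/-- `V = q^*θ` (class `v = [E₀ × o]`). -/
def lineV (θ : E₀.X.left.Modules) : (weilSurf E₀).X.left.Modules := pullLine (AbelianVariety.snd E₀ E₀) θ
/-- `Δ = (p − q)^*θ` (class `[Γ_1]`, the diagonal, for `θ = 𝒪(o)`: the kernel of `p − q`). -/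
def lineDiag (θ : E₀.X.left.Modules) : (weilSurf E₀).X.left.Modules :=
  pullLine (AbelianVariety.fst E₀ E₀ - AbelianVariety.snd E₀ E₀) θ
/-- `Γ = (p ≫ ψ − q)^*θ` (class `[Γ_ψ]`, the graph of `ψ`: the kernel of `ψ ∘ p − q`). -/
def lineGraph (θ : E₀.X.left.Modules) (ψ : E₀ ⟶ E₀) : (weilSurf E₀).X.left.Modules :=
  pullLine (AbelianVariety.fst E₀ E₀ ≫ ψ - AbelianVariety.snd E₀ E₀) θ
/-- `H = U ⊗ V` (class `h = u + v`). -/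
def lineH (θ : E₀.X.left.Modules) : (weilSurf E₀).X.left.Modules := tensorObj (lineU θ) (lineV θ)
/-- `D₁ = Δ ⊗ H^∨` (class `e₁ = [Γ_1] − u − v`; `e₁² = −2`). -/
def lineD₁ (θ : E₀.X.left.Modules) : (weilSurf E₀).X.left.Modules := tensorObj (lineDiag θ) (Modules.dual (lineH θ))
/-- `D₂ = Γ ⊗ H^∨` (class `e₂ = [Γ_ψ] − u − v`; `e₂² = −2`, `e₁·e₂ = 0`). -/
def lineD₂ (θ : E₀.X.left.Modules) (ψ : E₀ ⟶ E₀) : (weilSurf E₀).X.left.Modules :=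
  tensorObj (lineGraph θ ψ) (Modules.dual (lineH θ))

/-- **THE FACTOR LETTER `L_S(a, x, y) = H^{⊗a} ⊗ D₁^{⊗x} ⊗ D₂^{⊗y}`** on `S` (class `a(u+v) + x e₁ + y e₂ = a(u+v) + βe + β̄ē`, `β = x + iy`). -/
def factorLine (θ : E₀.X.left.Modules) (ψ : E₀ ⟶ E₀) (b : BPoint) : (weilSurf E₀).X.left.Modules :=
  tensorObj (tensorObj (zpowLine (lineH θ) b.1) (zpowLine (lineD₁ θ) b.2.1)) (zpowLine (lineD₂ θ ψ) b.2.2)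

/-- **THE LETTER BUNDLE OF A CELL `Z`**: `⊗_{f<4} π_f^* L_S(Z_f)` on `S⁴` (the external tensor product `⊠_f L_S(Z_f)`). -/
def letterBundle (θ : E₀.X.left.Modules) (ψ : E₀ ⟶ E₀) (Z : MCell) : (pad4Anchor E₀).X.left.Modules :=
  tensorObj (tensorObj (tensorObj (pullLine (padProj E₀ 0) (factorLine θ ψ (Z 0))) (pullLine (padProj E₀ 1) (factorLine θ ψ (Z 1))))
    (pullLine (padProj E₀ 2) (factorLine θ ψ (Z 2)))) (pullLine (padProj E₀ 3) (factorLine θ ψ (Z 3)))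

section RankOne

variable {θ : E₀.X.left.Modules} (hθ : HasRank θ 1) (ψ : E₀ ⟶ E₀)
include hθ

theorem hasRank_lineU : HasRank (lineU θ) 1 := hasRank_pullLine _ hθ
theorem hasRank_lineV : HasRank (lineV θ) 1 := hasRank_pullLine _ hθ
theorem hasRank_lineDiag : HasRank (lineDiag θ) 1 := hasRank_pullLine _ hθ
theorem hasRank_lineGraph : HasRank (lineGraph θ ψ) 1 := hasRank_pullLine _ hθ
theorem hasRank_lineH : HasRank (lineH θ) 1 := hasRank_tensorObj_one (hasRank_lineU hθ) (hasRank_lineV hθ)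
theorem hasRank_lineD₁ : HasRank (lineD₁ θ) 1 := hasRank_tensorObj_one (hasRank_lineDiag hθ) (hasRank_dual (hasRank_lineH hθ))
theorem hasRank_lineD₂ : HasRank (lineD₂ θ ψ) 1 :=
  hasRank_tensorObj_one (hasRank_lineGraph hθ ψ) (hasRank_dual (hasRank_lineH hθ))

/-- the factor letters have rank one. -/
theorem hasRank_factorLine (b : BPoint) : HasRank (factorLine θ ψ b) 1 :=
  hasRank_tensorObj_one (hasRank_tensorObj_one (hasRank_zpowLine (hasRank_lineH hθ) _) (hasRank_zpowLine (hasRank_lineD₁ hθ) _))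
    (hasRank_zpowLine (hasRank_lineD₂ hθ ψ) _)

/-- **THE LETTER BUNDLES HAVE EXACT RANK ONE.** -/
theorem hasRank_letterBundle (Z : MCell) : HasRank (letterBundle θ ψ Z) 1 :=
  hasRank_tensorObj_one (hasRank_tensorObj_one (hasRank_tensorObj_one (hasRank_pullLine _ (hasRank_factorLine hθ ψ _))
    (hasRank_pullLine _ (hasRank_factorLine hθ ψ _))) (hasRank_pullLine _ (hasRank_factorLine hθ ψ _)))
    (hasRank_pullLine _ (hasRank_factorLine hθ ψ _))

theorem not_isZero_letterBundle (Z : MCell) : ¬ IsZero (letterBundle θ ψ Z) :=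
  not_isZero_of_hasRank_one (hasRank_letterBundle hθ ψ Z)

end RankOne

/-- **THE LETTER MODEL OF `(θ, ψ)`** — an INSTANCE of the §43.3 interface for every rank-one module `θ` on `E₀` (INTENDED `θ = 𝒪_{E₀}(o)`,
`ψ = ψ₀`). -/
def letterModelOf (θ : E₀.X.left.Modules) (hθ : HasRank θ 1) (ψ : E₀ ⟶ E₀) : LetterModel E₀ :=
  ⟨letterBundle θ ψ, hasRank_letterBundle hθ ψ⟩

@[simp] theorem letterModelOf_bundle (θ : E₀.X.left.Modules) (hθ : HasRank θ 1) (ψ : E₀ ⟶ E₀) (Z : MCell) :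
    (letterModelOf θ hθ ψ).bundle Z = letterBundle θ ψ Z := rfl

/-- HONEST SIGNAL: the interface ALONE is weak — it is inhabited on every anchor by the DISHONEST model of the trivial bundle `θ = 𝒪_{E₀}` (all
letters `≅ 𝒪`, not separating).  The content of a pin is the choice `θ = 𝒪_{E₀}(o)` (definition item) and `Separating`. -/
theorem letterModel_nonempty (E₀ : AbelianVariety ℂ) (ψ : E₀ ⟶ E₀) : Nonempty (LetterModel E₀) :=
  ⟨letterModelOf (Modules.unitModule E₀.X.left) Modules.hasRank_unitModule ψ⟩

end Construction

/-- **THE LETTER LAW of a rank-one module per anchor** (INTENDED `θ E₀ = 𝒪_{E₀}(o)`): the datum is pinned to `letterModelOf (θ E₀) _ ψ₀`. -/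
def letterLaw (θ : ∀ E₀ : AbelianVariety ℂ, E₀.X.left.Modules) (hθ : ∀ E₀, HasRank (θ E₀) 1) : DatumLaw :=
  pinnedLaw fun E₀ ψ₀ => letterModelOf (θ E₀) (hθ E₀) ψ₀

theorem letterLaw_iff (θ : ∀ E₀ : AbelianVariety ℂ, E₀.X.left.Modules) (hθ : ∀ E₀, HasRank (θ E₀) 1) {E₀ : AbelianVariety ℂ} {ψ₀ : E₀ ⟶ E₀}
    (δ : SplitBlockDatum₀ E₀ ψ₀) : letterLaw θ hθ E₀ ψ₀ δ ↔ δ.PinnedTo (letterModelOf (θ E₀) (hθ E₀) ψ₀) :=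
  Iff.rfl

/-! ## §43.6 (R3, the pin) the origin line bundle `θ₀ = 𝒪_{E₀}(o)`, the parameter-free letter model and the law of record `originLaw` -/

section Origin

/-- the origin of `E₀` as a complex point `o ∈ E₀(ℂ)`: the unit section `Spec ℂ → E₀` (`AbelianVariety.unitPt`) as an `AlgPoints.mk`. -/
def originPt (E₀ : AbelianVariety ℂ) : ComplexPoints E₀.X :=
  AlgPoints.mk (AbelianVariety.unitPt E₀) (by
    rw [AbelianVariety.unitPt_comp_hom]
    exact (Spec.map_id _).symm)

/-- its underlying scheme point is the tree's `AbelianVariety.origin E₀`. -/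
theorem originPt_pt (E₀ : AbelianVariety ℂ) : (originPt E₀).pt = AbelianVariety.origin E₀ := rfl

/-- a one-dimensional abelian variety is a smooth curve (`smoothOfRelativeDimension_dim` at `dim = 1`). -/
theorem smoothOfRelativeDimension_one (E₀ : AbelianVariety ℂ) (h1 : E₀.dim = 1) : SmoothOfRelativeDimension 1 E₀.X.hom :=
  h1 ▸ E₀.smoothOfRelativeDimension_dim

/-- the origin of a one-dimensional complex abelian variety is NOT the generic point (a complex point of a smooth curve is closed:
`HodgeTheory.pt_ne_genericPoint`). -/
theorem origin_ne_genericPoint (E₀ : AbelianVariety ℂ) (h1 : E₀.dim = 1) : AbelianVariety.origin E₀ ≠ genericPoint E₀.X.left := by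
  haveI : IsIntegral E₀.X.left := GeometricallyIntegral.isIntegral_of_subsingleton E₀.X.hom
  haveI : SmoothOfRelativeDimension 1 E₀.X.hom := smoothOfRelativeDimension_one E₀ h1
  exact originPt_pt E₀ ▸ pt_ne_genericPoint (C := E₀.X) (originPt E₀)

/-- **the origin divisor `[o]`** of the elliptic curve `E₀`: the reduced effective Cartier divisor supported at the origin
(tree `Motives.CurvePlaces.pointDivisor`; Hartshorne II, Prop. 6.11). -/
def originDivisor (E₀ : AbelianVariety ℂ) (h1 : E₀.dim = 1) : CartierDivisor E₀.X.left :=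
  haveI : IsIntegral E₀.X.left := GeometricallyIntegral.isIntegral_of_subsingleton E₀.X.hom
  haveI : SmoothOfRelativeDimension 1 E₀.X.hom := smoothOfRelativeDimension_one E₀ h1
  CurvePlaces.pointDivisor E₀.X (origin_ne_genericPoint E₀ h1)

/-- **THE ORIGIN LINE BUNDLE `θ₀ = 𝒪_{E₀}(o)`**: the tree's `Modules.lineBundle` of the unit cocycle of `[o]` (Görtz–Wedhorn I, Prop. 11.21). -/
def originLine (E₀ : AbelianVariety ℂ) (h1 : E₀.dim = 1) : E₀.X.left.Modules :=
  lineBundle (originDivisor E₀ h1).toUnitCocycle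

/-- `𝒪_{E₀}(o)` has rank one. -/
theorem hasRank_originLine (E₀ : AbelianVariety ℂ) (h1 : E₀.dim = 1) : HasRank (originLine E₀ h1) 1 :=
  UnitCocycle.hasRank_lineBundle _

/-- **THE PARAMETER-FREE LETTER MODEL**: `Z ↦ letterBundle 𝒪_{E₀}(o) ψ₀ Z = ⊗_f π_f^* (H^{a_f} ⊗ D₁^{x_f} ⊗ D₂^{y_f})`. -/
def originModel (E₀ : AbelianVariety ℂ) (h1 : E₀.dim = 1) (ψ : E₀ ⟶ E₀) : LetterModel E₀ :=
  letterModelOf (originLine E₀ h1) (hasRank_originLine E₀ h1) ψ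

@[simp] theorem originModel_bundle (E₀ : AbelianVariety ℂ) (h1 : E₀.dim = 1) (ψ : E₀ ⟶ E₀) (Z : MCell) :
    (originModel E₀ h1 ψ).bundle Z = letterBundle (originLine E₀ h1) ψ Z := rfl

theorem not_isZero_originModel (E₀ : AbelianVariety ℂ) (h1 : E₀.dim = 1) (ψ : E₀ ⟶ E₀) (Z : MCell) : ¬ IsZero ((originModel E₀ h1 ψ).bundle Z) :=
  (originModel E₀ h1 ψ).not_isZero Z

/-- **THE LAW OF RECORD `originLaw`** (slot `Λ` of v42.1 `Rung2a₀Under`): the datum's letters ARE, up to isomorphism, the origin letters of their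
cells — `∃ h1 : E₀.dim = 1, δ.PinnedTo (originModel E₀ h1 ψ₀)` (the `∃` over the proof-irrelevant `h1` makes the law FALSE off dimension one, so a kill
`¬ originLaw …` needs no dimension hypothesis; under `Rung2a₀Under` the binder `E₀.dim = 1` is present anyway). -/
def originLaw : DatumLaw := fun E₀ ψ₀ δ => ∃ h1 : E₀.dim = 1, δ.PinnedTo (originModel E₀ h1 ψ₀)

theorem originLaw_iff {E₀ : AbelianVariety ℂ} {ψ₀ : E₀ ⟶ E₀} (h1 : E₀.dim = 1) (δ : SplitBlockDatum₀ E₀ ψ₀) :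
    originLaw E₀ ψ₀ δ ↔ δ.PinnedTo (originModel E₀ h1 ψ₀) :=
  ⟨fun ⟨_, h⟩ => h, fun h => ⟨h1, h⟩⟩

theorem originLaw.dim_eq_one {E₀ : AbelianVariety ℂ} {ψ₀ : E₀ ⟶ E₀} {δ : SplitBlockDatum₀ E₀ ψ₀} (h : originLaw E₀ ψ₀ δ) : E₀.dim = 1 := h.1

theorem originLaw.pinnedTo {E₀ : AbelianVariety ℂ} {ψ₀ : E₀ ⟶ E₀} {δ : SplitBlockDatum₀ E₀ ψ₀} (h : originLaw E₀ ψ₀ δ) :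
    δ.PinnedTo (originModel E₀ h.dim_eq_one ψ₀) := h.2

/-- the origin law implies the rank-one law (R1 is the interim it subsumes). -/
theorem rankOneLaw_of_originLaw {E₀ : AbelianVariety ℂ} {ψ₀ : E₀ ⟶ E₀} {δ : SplitBlockDatum₀ E₀ ψ₀} (h : originLaw E₀ ψ₀ δ) : rankOneLaw E₀ ψ₀ δ :=
  h.pinnedTo.lettersRankOne

/-- no pinned datum has a zero letter (the (i)-kill, unconditional), `P`-side … -/
theorem originLaw.not_isZero_P {E₀ : AbelianVariety ℂ} {ψ₀ : E₀ ⟶ E₀} {δ : SplitBlockDatum₀ E₀ ψ₀} (h : originLaw E₀ ψ₀ δ) {Z : MCell}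
    (hZ : Z ∈ δ.Dsh.cfg.upper) : ¬ IsZero (δ.termP.kit.L Z) :=
  SplitBlockCore₀.PinnedTo.not_isZero_P h.pinnedTo hZ

/-- … and `N`-side. -/
theorem originLaw.not_isZero_N {E₀ : AbelianVariety ℂ} {ψ₀ : E₀ ⟶ E₀} {δ : SplitBlockDatum₀ E₀ ψ₀} (h : originLaw E₀ ψ₀ δ) {Z : MCell}
    (hZ : Z ∈ δ.Dsh.cfg.lower) : ¬ IsZero (δ.termN.kit.L Z) :=
  SplitBlockCore₀.PinnedTo.not_isZero_N h.pinnedTo hZ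

/-- **THE ONE REMAINING TYPED OBLIGATION** for the (ii)-kill (relabelling): the origin letters SEPARATE cells — on a one-dimensional `E₀` with CM
generator `ψ₀` (`ψ₀² = −1`), `letterBundle 𝒪(o) ψ₀ Z ≅ letterBundle 𝒪(o) ψ₀ Z' → Z = Z'`.  Documented TRUE (Néron–Severi of `S = E₀²`: `u + v, e₁, e₂`
have Gram matrix `diag(2, −2, −2)`, so `(a, x, y) ↦ a(u+v) + x e₁ + y e₂` is injective, and `Pic(S⁴) ⊇ ⊕_f π_f^* NS(S)`); NOT proved in this file. -/
def OriginSeparating : Prop :=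
  ∀ (E₀ : AbelianVariety ℂ) (h1 : E₀.dim = 1) (ψ₀ : E₀ ⟶ E₀), ψ₀ ≫ ψ₀ = -(1 • 𝟙 E₀) → (originModel E₀ h1 ψ₀).Separating

/-- **RUNG 2a₀ PINNED TO THE ORIGIN LETTERS** — v42.1's `Rung2a₀Under` at the law of record (no parameter). -/
def Rung2a₀Origin (h : ℤ) : Prop := Rung2a₀Under originLaw h

theorem rung2a₀_of_rung2a₀Origin {h : ℤ} (H : Rung2a₀Origin h) : Rung2a₀ h := Rung2a₀Under.rung2a₀ H

theorem rung2a₀Under_rankOneLaw_of_rung2a₀Origin {h : ℤ} (H : Rung2a₀Origin h) : Rung2a₀Under rankOneLaw h := by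
  obtain ⟨E₀, ψ₀, h1, hψ, δ, hΛ, hpos, hpass, hrows⟩ := H
  exact ⟨E₀, ψ₀, h1, hψ, δ, rankOneLaw_of_originLaw hΛ, hpos, hpass, hrows⟩

/-- an origin-pinned rung is a pinned rung for the (global) model `originModel` completed off dimension one by any model (here: itself is only
needed at the witness, whose `E₀` has `dim = 1`). -/
theorem rung2a₀Under_pinnedLaw_of_rung2a₀Origin {h : ℤ} (H : Rung2a₀Origin h) :
    ∃ ℓ : LetterModels, Rung2a₀Pinned ℓ h := by
  classical
  obtain ⟨E₀, ψ₀, h1, hψ, δ, hΛ, hpos, hpass, hrows⟩ := H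
  refine ⟨fun E ψ => if hE : E.dim = 1 then originModel E hE ψ else Classical.choice (letterModel_nonempty E ψ), ?_⟩
  refine ⟨E₀, ψ₀, h1, hψ, δ, ?_, hpos, hpass, hrows⟩
  show δ.PinnedTo (if hE : E₀.dim = 1 then originModel E₀ hE ψ₀ else Classical.choice (letterModel_nonempty E₀ ψ₀))
  rw [dif_pos h1]
  exact hΛ.pinnedTo

end Origin

/-! ## §43.7 audit -/

/-- AUDIT: nothing is decided here — interface, pinning predicate, construction and rank-one theorems; no datum, no design, no rung. -/
theorem audit_nothing_decided_letterBundle : True := trivial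

end SplitBlock

end Summit.HodgeConjecture.HodgeConjecture.Cruxes.BlochSeedDiscOne.SeedChecker

end
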